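import Literature.Analysis.FluidPDE.Tao2016AveragedNS.SeedScaleClosure
import HarnessLib

/-!
# Theorem 5.3, TIMED, along every pseudo-orbit: quiet on `[0, 7/5]`, fired on `[7/4, 2]`

Cell `pub-fluidc`, blueprint seat 1 (gen 14). HONEST FRAMING: low prior, high value-of-information
experiment on Tao's machine paradigm [Tao2016AveragedNS, §5.5]; NOT a claim that NS blows up.

`IsPseudoOrbit.fired_from_two` (SeedScaleClosure.lean) transferred the FIRED half of Theorem 5.3 at
the seed scale from differentiable approximate trajectories to genuine pseudo-orbits (continuous on
`[0,T]`, right-differentiable on `[0,T)`, sup-defect `≤ δ`). The assembly of gates into a clocked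
machine needs BOTH sides of the transition time: the gate must NOT fire early. This file transfers
the TIMED form `approxTrajectory_transition_timed` (SeedScaleTiming.lean) by the same smoothing
argument, packaged once and for all:

* `IsPseudoOrbit.exists_approxTrajectory` — **the transfer device**: a continuous pseudo-orbit of a
  member within a budget STRICTLY inside `ε²e^{-M}/(8√M)` is, for every `η > 0`, within `η` on
  `[0,T]` (coordinatewise) of a differentiable approximate trajectory satisfying ALL standing
  hypotheses of the seed-scale chain (velocity, sup-defect `δ'`, sup-ball `2`, datum `δ₀'`,
  `δ₀' + δ'T ≤ ε²e^{-M}/(8√M)`) — so every chain statement with a closed conclusion transfers;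
* `Ignition.abs_sub_le_of_approx`, `Ignition.le_sq_of_approx` — passage to the limit `η → 0` in the
  two conclusion shapes `|y - m| ≤ c` and `l ≤ y²`;
* `IsPseudoOrbit.transition_timed` — **Theorem 5.3 timed, along every pseudo-orbit** with
  `δ₀ + δT < ε²e^{-M}/(8√M)`: QUIET on `[0, 7/5]` (`|ã|, |d| ≤ 4K⁻¹⁰`, `|c| ≤ ε²K⁻¹⁰`, `|b| ≤ 2ε`,
  `a² ≥ 0.999`) and FIRED on `[7/4, 2]` (`|ã - 1| ≤ 4K⁻²⁰`, `|a|, |b|, |c|, |d| ≤ 2K⁻¹⁰`); the one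
  strict inequality `|c| < ε²K⁻¹⁰` of the differentiable version becomes `≤` in the limit;
* `IsPseudoOrbit.transition_timed_pow` — the same under the K-power budget `δ₀ + δT ≤ ε²e^{-M}/K⁶`.

Together with `IsPseudoOrbit.fired_from_two` (fired on all of `[2,T]`) this is the complete
gate-level statement the cell's assembly consumes for genuine pseudo-orbits: transition time in
`[7/5, 7/4]`, uniformly over the retuned family and over all perturbations within the budget.
-/

namespace Literature.Analysis.FluidPDE.Tao2016AveragedNS

open Real Set
open scoped NNReal

namespace Ignition

/-- Passage to the limit, shape `|y - m| ≤ c`: if `y` is approximated to every precision by reals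
`z` with `|z - m| ≤ c`, then `|y - m| ≤ c`. [folklore] -/
theorem abs_sub_le_of_approx {y m c : ℝ}
    (h : ∀ η : ℝ, 0 < η → ∃ z : ℝ, |z - y| ≤ η ∧ |z - m| ≤ c) : |y - m| ≤ c := by
  refine le_of_forall_pos_le_add fun η hη => ?_
  obtain ⟨z, hzy, hzm⟩ := h η hη
  rw [show y - m = (z - m) - (z - y) by ring]
  exact (abs_sub _ _).trans (by linarith)

/-- Passage to the limit, shape `l ≤ y²`: if `|y| ≤ B` and `y` is approximated to every precision by
reals `z` with `l ≤ z²`, then `l ≤ y²`. [folklore] -/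
theorem le_sq_of_approx {y l B : ℝ} (hB : 0 ≤ B) (hy : |y| ≤ B)
    (h : ∀ η : ℝ, 0 < η → ∃ z : ℝ, |z - y| ≤ η ∧ l ≤ z ^ 2) : l ≤ y ^ 2 := by
  refine le_of_forall_pos_le_add fun η hη => ?_
  have h2B : 0 < 2 * B + 1 := by linarith
  obtain ⟨z, hzy, hlz⟩ := h (min (η / (2 * B + 1)) 1) (lt_min (by positivity) one_pos)
  obtain ⟨w, hw⟩ : ∃ w : ℝ, w = z - y := ⟨_, rfl⟩
  have hz : z = y + w := by rw [hw]; ring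
  rw [← hw] at hzy
  have h1 : |w| ≤ η / (2 * B + 1) := hzy.trans (min_le_left _ _)
  have h2 : |w| ≤ 1 := hzy.trans (min_le_right _ _)
  have hw0 : 0 ≤ |w| := abs_nonneg w
  have h3 : 2 * y * w ≤ 2 * B * |w| := by
    calc 2 * y * w ≤ |2 * y * w| := le_abs_self _
      _ = 2 * |y| * |w| := by rw [abs_mul, abs_mul, abs_two]
      _ ≤ 2 * B * |w| := by gcongr
  have h4 : w ^ 2 ≤ |w| := by
    calc w ^ 2 = |w| * |w| := by rw [← sq_abs]; ring
      _ ≤ 1 * |w| := by gcongr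
      _ = |w| := one_mul _
  have h5 : (2 * B + 1) * |w| ≤ η := by
    calc (2 * B + 1) * |w| ≤ (2 * B + 1) * (η / (2 * B + 1)) := by gcongr
      _ = η := by field_simp
  have h6 : z ^ 2 = y ^ 2 + 2 * y * w + w ^ 2 := by rw [hz]; ring
  nlinarith

end Ignition

section Member

variable {K M ε δ δ₀ T : ℝ} {Y : ℝ → Fin 5 → ℝ}

/-- **The transfer device.** A globally continuous `δ`-pseudo-orbit of a member in the sup-ball of
radius `2` on `[0,T]` (`T ≥ 2`), issued `δ₀`-close to (5.6) with `δ₀ + δT < ε²e^{-M}/(8√M)` (strict),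
is for every `η > 0` coordinatewise within `η` on `[0,T]` of a DIFFERENTIABLE approximate trajectory
`Z` (velocity `W` on `ℝ`) satisfying every standing hypothesis of the seed-scale chain: sup-defect
`δ'` and sup-norm `≤ 2` on `[0,T)`, datum `δ₀'`, and `δ₀' + δ'T ≤ ε²e^{-M}/(8√M)`. (Smoothing lemma
with `η' = min(η, slack/(1+T), 1/2)` and the a-priori bound `‖Y‖ ≤ 6/5`.)
[cite: Tao2016AveragedNS, §5.5 Theorem 5.3] -/
theorem IsPseudoOrbit.exists_approxTrajectory (hY : IsPseudoOrbit (delayCircuitWith K M ε) δ 2 T Y)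
    (hYc : Continuous Y) (hK : 2 * 20 ^ 42 * (Nat.factorial 42 : ℝ) + 16 ≤ K)
    (hML : 3000 * Real.log K ≤ M) (hMK : M ≤ K ^ 10) (hε : 0 < ε)
    (hεle : ε ≤ exp (-(10 * M)) / K ^ 100) (hT : 2 ≤ T) (h0 : ‖Y 0 - delayInit‖ ≤ δ₀)
    (hB : δ₀ + δ * T < ε ^ 2 * exp (-M) / (8 * Real.sqrt M)) {η : ℝ} (hη : 0 < η) :
    ∃ (δ' δ₀' : ℝ) (Z W : ℝ → Fin 5 → ℝ), (∀ t, HasDerivAt Z (W t) t) ∧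
      (∀ t ∈ Ico 0 T, ‖W t - delayCircuitWith K M ε (Z t)‖ ≤ δ') ∧ (∀ t ∈ Ico 0 T, ‖Z t‖ ≤ 2) ∧
      ‖Z 0 - delayInit‖ ≤ δ₀' ∧ δ₀' + δ' * T ≤ ε ^ 2 * exp (-M) / (8 * Real.sqrt M) ∧
      ∀ t ∈ Icc 0 T, ∀ i : Fin 5, |Z t i - Y t i| ≤ η := by
  obtain ⟨-, hε1, hε2, hexpM, -, -, -, h77, -⟩ := Ignition.ignition_params hK hML hMK hε hεle
  have hT0 : 0 < T := by linarith
  have hδ : 0 ≤ δ := by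
    obtain ⟨V, -, hV⟩ := hY.defect 0 ⟨le_rfl, hT0⟩
    exact (norm_nonneg _).trans hV
  have hδ₀ : 0 ≤ δ₀ := (norm_nonneg _).trans h0
  have hδT : 0 ≤ δ * T := by positivity
  have hs0 : 0 < ε ^ 2 * exp (-M) := by positivity
  have hb8 : ε ^ 2 * exp (-M) / (8 * Real.sqrt M) ≤ 1 / 100 := by
    have h1 : ε ^ 2 * exp (-M) / (8 * Real.sqrt M) ≤ ε ^ 2 * exp (-M) :=
      div_le_self hs0.le (by linarith)
    have h2 : ε ^ 2 * exp (-M) ≤ ε ^ 2 * 1 := by gcongr; linarith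
    linarith
  have hR₀ : ∀ t ∈ Icc 0 T, ‖Y t‖ ≤ 6 / 5 :=
    hY.norm_le_six_fifths hδ h0 (by linarith) (by linarith)
  have hF : Continuous (delayCircuitWith K M ε) := continuous_delayCircuitWith K M ε
  obtain ⟨η₀, hη₀⟩ : ∃ η₀ : ℝ,
      η₀ = (ε ^ 2 * exp (-M) / (8 * Real.sqrt M) - (δ₀ + δ * T)) / (1 + T) := ⟨_, rfl⟩
  have hη₀pos : 0 < η₀ := by rw [hη₀]; exact div_pos (by linarith) (by linarith)
  have hη₀T : η₀ * (1 + T) = ε ^ 2 * exp (-M) / (8 * Real.sqrt M) - (δ₀ + δ * T) := by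
    rw [hη₀]; field_simp
  obtain ⟨η', hη'⟩ : ∃ η' : ℝ, η' = min η (min η₀ (1 / 2)) := ⟨_, rfl⟩
  have hη'0 : 0 < η' := by rw [hη']; exact lt_min hη (lt_min hη₀pos (by norm_num))
  have hη'η : η' ≤ η := by rw [hη']; exact min_le_left _ _
  have hη'η₀ : η' ≤ η₀ := by rw [hη']; exact (min_le_right _ _).trans (min_le_left _ _)
  have hη'2 : η' ≤ 1 / 2 := by rw [hη']; exact (min_le_right _ _).trans (min_le_right _ _)
  obtain ⟨Z, W, hZd, hWd, hZn, hZY⟩ := hY.exists_smooth_approx hF hYc hT0 hR₀ hη'0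
  have hR : ∀ s ∈ Ico 0 T, ‖Z s‖ ≤ 2 := fun s hs =>
    (hZn s ⟨hs.1, hs.2.le⟩).trans (by linarith)
  have h0' : ‖Z 0 - delayInit‖ ≤ δ₀ + η' := by
    calc ‖Z 0 - delayInit‖ = ‖(Z 0 - Y 0) + (Y 0 - delayInit)‖ := by rw [sub_add_sub_cancel]
      _ ≤ ‖Z 0 - Y 0‖ + ‖Y 0 - delayInit‖ := norm_add_le _ _
      _ ≤ δ₀ + η' := by linarith [hZY 0 ⟨le_rfl, hT0.le⟩]
  have hB' : (δ₀ + η') + (δ + η') * T ≤ ε ^ 2 * exp (-M) / (8 * Real.sqrt M) := by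
    have h1 : η' * (1 + T) ≤ η₀ * (1 + T) := mul_le_mul_of_nonneg_right hη'η₀ (by linarith)
    nlinarith
  refine ⟨δ + η', δ₀ + η', Z, W, hZd, hWd, hR, h0', hB', fun t ht i => ?_⟩
  have h1 := norm_le_pi_norm (Z t - Y t) i
  rw [Pi.sub_apply, Real.norm_eq_abs] at h1
  exact h1.trans ((hZY t ht).trans hη'η)

/-- **Theorem 5.3, timed, along every pseudo-orbit within the seed-scale budget (open form).** For a
member `delayCircuitWith K M ε` and a `δ`-pseudo-orbit `Y` in the sup-ball of radius `2` on `[0,T]`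
(`T ≥ 2`; continuous on `[0,T]`, right-differentiable on `[0,T)`) issued `δ₀`-close to (5.6) with
`δ₀ + δT < ε²e^{-M}/(8√M)`: the pseudo-orbit is QUIET on `[0, 7/5]` — `|ã|, |d| ≤ 4K⁻¹⁰`,
`|c| ≤ ε²K⁻¹⁰`, `|b| ≤ 2ε`, `a² ≥ 0.999` — and FIRED on `[7/4, 2]` — `|ã - 1| ≤ 4K⁻²⁰`,
`|a|, |b|, |c|, |d| ≤ 2K⁻¹⁰`. So the transition time lies in `[7/5, 7/4]` along EVERY pseudo-orbit.
[cite: Tao2016AveragedNS, §5.5 Theorem 5.3] -/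
theorem IsPseudoOrbit.transition_timed (hY : IsPseudoOrbit (delayCircuitWith K M ε) δ 2 T Y)
    (hK : 2 * 20 ^ 42 * (Nat.factorial 42 : ℝ) + 16 ≤ K) (hML : 3000 * Real.log K ≤ M)
    (hMK : M ≤ K ^ 10) (hε : 0 < ε) (hεle : ε ≤ exp (-(10 * M)) / K ^ 100) (hT : 2 ≤ T)
    (h0 : ‖Y 0 - delayInit‖ ≤ δ₀) (hB : δ₀ + δ * T < ε ^ 2 * exp (-M) / (8 * Real.sqrt M)) :
    (∀ t ∈ Icc (0 : ℝ) (7 / 5), |Y t 4| ≤ 4 / K ^ 10 ∧ |Y t 3| ≤ 4 / K ^ 10 ∧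
        |Y t 2| ≤ ε ^ 2 / K ^ 10 ∧ |Y t 1| ≤ 2 * ε ∧ 999 / 1000 ≤ Y t 0 ^ 2) ∧
      ∀ t ∈ Icc (7 / 4 : ℝ) 2,
        |Y t 4 - 1| ≤ 4 / K ^ 20 ∧ ∀ i : Fin 5, i ≠ 4 → |Y t i| ≤ 2 / K ^ 10 := by
  have hT0 : 0 < T := by linarith
  have hδ : 0 ≤ δ := by
    obtain ⟨V, -, hV⟩ := hY.defect 0 ⟨le_rfl, hT0⟩
    exact (norm_nonneg _).trans hV
  obtain ⟨-, hε1, hε2, hexpM, -, -, -, h77, -⟩ := Ignition.ignition_params hK hML hMK hε hεle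
  have hs0 : 0 < ε ^ 2 * exp (-M) := by positivity
  have hb8 : ε ^ 2 * exp (-M) / (8 * Real.sqrt M) ≤ 1 / 100 := by
    have h1 : ε ^ 2 * exp (-M) / (8 * Real.sqrt M) ≤ ε ^ 2 * exp (-M) :=
      div_le_self hs0.le (by linarith)
    have h2 : ε ^ 2 * exp (-M) ≤ ε ^ 2 * 1 := by gcongr; linarith
    linarith
  have hδ₀ : 0 ≤ δ₀ := (norm_nonneg _).trans h0
  have hδT : 0 ≤ δ * T := by positivity
  -- WLOG `Y` is globally continuous
  obtain ⟨Yc, hYcc, hYcY, hYc⟩ := hY.exists_continuous hT0.le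
  have h0c : ‖Yc 0 - delayInit‖ ≤ δ₀ := by rw [hYcY ⟨le_rfl, hT0.le⟩]; exact h0
  have hR₀ : ∀ t ∈ Icc 0 T, ‖Yc t‖ ≤ 6 / 5 :=
    hYc.norm_le_six_fifths hδ h0c (by linarith) (by linarith)
  -- the timed conclusions for the approximants, with coordinates within `η`
  have key : ∀ η : ℝ, 0 < η → ∃ Z : ℝ → Fin 5 → ℝ, (∀ t ∈ Icc 0 T, ∀ i : Fin 5, |Z t i - Yc t i| ≤ η) ∧
      (∀ t ∈ Icc (0 : ℝ) (7 / 5), |Z t 4| ≤ 4 / K ^ 10 ∧ |Z t 3| ≤ 4 / K ^ 10 ∧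
        |Z t 2| < ε ^ 2 / K ^ 10 ∧ |Z t 1| ≤ 2 * ε ∧ 999 / 1000 ≤ Z t 0 ^ 2) ∧
      ∀ t ∈ Icc (7 / 4 : ℝ) 2,
        |Z t 4 - 1| ≤ 4 / K ^ 20 ∧ ∀ i : Fin 5, i ≠ 4 → |Z t i| ≤ 2 / K ^ 10 := by
    intro η hη
    obtain ⟨δ', δ₀', Z, W, hZd, hWd, hR, h0', hB', hZY⟩ :=
      hYc.exists_approxTrajectory hYcc hK hML hMK hε hεle hT h0c hB hη
    exact ⟨Z, hZY, approxTrajectory_transition_timed K M ε δ' δ₀' T Z W hK hML hMK hε hεle hT hZd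
      hWd hR h0' hB'⟩
  refine ⟨fun t ht => ?_, fun t ht => ?_⟩
  · have htT : t ∈ Icc 0 T := ⟨ht.1, by linarith [ht.2]⟩
    rw [← hYcY htT]
    refine ⟨?_, ?_, ?_, ?_, ?_⟩
    · rw [← sub_zero (Yc t 4)]
      refine Ignition.abs_sub_le_of_approx fun η hη => ?_
      obtain ⟨Z, hZY, hq, -⟩ := key η hη
      exact ⟨Z t 4, hZY t htT 4, by rw [sub_zero]; exact (hq t ht).1⟩
    · rw [← sub_zero (Yc t 3)]
      refine Ignition.abs_sub_le_of_approx fun η hη => ?_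
      obtain ⟨Z, hZY, hq, -⟩ := key η hη
      exact ⟨Z t 3, hZY t htT 3, by rw [sub_zero]; exact (hq t ht).2.1⟩
    · rw [← sub_zero (Yc t 2)]
      refine Ignition.abs_sub_le_of_approx fun η hη => ?_
      obtain ⟨Z, hZY, hq, -⟩ := key η hη
      exact ⟨Z t 2, hZY t htT 2, by rw [sub_zero]; exact (hq t ht).2.2.1.le⟩
    · rw [← sub_zero (Yc t 1)]
      refine Ignition.abs_sub_le_of_approx fun η hη => ?_
      obtain ⟨Z, hZY, hq, -⟩ := key η hη
      exact ⟨Z t 1, hZY t htT 1, by rw [sub_zero]; exact (hq t ht).2.2.2.1⟩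
    · have hy : |Yc t 0| ≤ 6 / 5 := by
        have h1 := norm_le_pi_norm (Yc t) 0
        rw [Real.norm_eq_abs] at h1
        exact h1.trans (hR₀ t htT)
      refine Ignition.le_sq_of_approx (by norm_num) hy fun η hη => ?_
      obtain ⟨Z, hZY, hq, -⟩ := key η hη
      exact ⟨Z t 0, hZY t htT 0, (hq t ht).2.2.2.2⟩
  · have htT : t ∈ Icc 0 T := ⟨by linarith [ht.1], by linarith [ht.2]⟩
    rw [← hYcY htT]
    refine ⟨?_, fun i hi => ?_⟩
    · refine Ignition.abs_sub_le_of_approx fun η hη => ?_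
      obtain ⟨Z, hZY, -, hf⟩ := key η hη
      exact ⟨Z t 4, hZY t htT 4, (hf t ht).1⟩
    · rw [← sub_zero (Yc t i)]
      refine Ignition.abs_sub_le_of_approx fun η hη => ?_
      obtain ⟨Z, hZY, -, hf⟩ := key η hη
      exact ⟨Z t i, hZY t htT i, by rw [sub_zero]; exact (hf t ht).2 i hi⟩

/-- **Theorem 5.3, timed, along every pseudo-orbit, K-power budget.** The same conclusions under
`δ₀ + δT ≤ ε²e^{-M}/K⁶` (strictly inside `ε²e^{-M}/(8√M)`). [cite: Tao2016AveragedNS, §5.5 Theorem 5.3] -/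
theorem IsPseudoOrbit.transition_timed_pow (hY : IsPseudoOrbit (delayCircuitWith K M ε) δ 2 T Y)
    (hK : 2 * 20 ^ 42 * (Nat.factorial 42 : ℝ) + 16 ≤ K) (hML : 3000 * Real.log K ≤ M)
    (hMK : M ≤ K ^ 10) (hε : 0 < ε) (hεle : ε ≤ exp (-(10 * M)) / K ^ 100) (hT : 2 ≤ T)
    (h0 : ‖Y 0 - delayInit‖ ≤ δ₀) (hB : δ₀ + δ * T ≤ ε ^ 2 * exp (-M) / K ^ 6) :
    (∀ t ∈ Icc (0 : ℝ) (7 / 5), |Y t 4| ≤ 4 / K ^ 10 ∧ |Y t 3| ≤ 4 / K ^ 10 ∧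
        |Y t 2| ≤ ε ^ 2 / K ^ 10 ∧ |Y t 1| ≤ 2 * ε ∧ 999 / 1000 ≤ Y t 0 ^ 2) ∧
      ∀ t ∈ Icc (7 / 4 : ℝ) 2,
        |Y t 4 - 1| ≤ 4 / K ^ 20 ∧ ∀ i : Fin 5, i ≠ 4 → |Y t i| ≤ 2 / K ^ 10 :=
  hY.transition_timed hK hML hMK hε hεle hT h0 (hB.trans_lt (seedBudget_pow_lt hK hML hMK hε hεle))

end Member

end Literature.Analysis.FluidPDE.Tao2016AveragedNS
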